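import Mathlib
import Literature.MathematicalPhysics.QuantumLattice.YangMillsClassical
import HarnessLib

/-!
# Zero-mode action floor — regularity bookkeeping (lead c7, line `zero-mode-floor-dilute-gas` of crux
`NestedDissectionSea.EarlyCrosserLaw`, stmt-QuantumFields-13995)

Helpers for the registered stub `stub_floorAssembly`: smoothness of the components of a smooth spinor
field `ψ : ℝ⁴ → ℂ⁴ ⊗ ℂ³`, of their partial derivatives, of the entries of a smooth connection `A`, of
the covariant-derivative components `(∇_μψ)_{sc} = ∂_μψ_{sc} + Σ_{c'} (A_μ)_{cc'} ψ_{sc'}` and of the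
real pairings `Re⟨ψ, ∇_μψ⟩`; continuity of the curvature; and anti-Hermiticity of the curvature of an
anti-Hermitian smooth connection.
-/

noncomputable section

open scoped BigOperators Matrix ContDiff Matrix.Norms.Frobenius
open Literature.MathematicalPhysics.QuantumLattice

namespace Summit.QuantumFields.QCD.Cruxes.EarlyCrosserLaw.ZeroModeFloorDiluteGas

variable {n : WithTop ℕ∞}

/-- Components of a `Cⁿ` spinor field are `Cⁿ`. -/
theorem contDiff_spinor_component {ψ : EuclideanSpace ℝ (Fin 4) → Fin 4 → Fin 3 → ℂ}
    (hψ : ContDiff ℝ n ψ) (s : Fin 4) (c : Fin 3) : ContDiff ℝ n fun x => ψ x s c :=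
  contDiff_pi.1 (contDiff_pi.1 hψ s) c

/-- Extraction of the `(c, c')` entry of a complex `3 × 3` matrix, as a real continuous linear map
for the Frobenius norm (a term, not a definition: `LinearMap.toContinuousLinearMap` of Mathlib's
`Matrix.entryLinearMap`). -/
theorem entryCLM_apply (c c' : Fin 3) (M : Matrix (Fin 3) (Fin 3) ℂ) :
    LinearMap.toContinuousLinearMap (Matrix.entryLinearMap ℝ ℂ c c') M = M c c' := rfl

/-- Entries of a smooth connection (as functions of the base point) are smooth. -/
theorem contDiff_connection_entry {A : Connection (EuclideanSpace ℝ (Fin 4)) (Matrix (Fin 3) (Fin 3) ℂ)}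
    (hA : IsSmoothConnection A) (v : EuclideanSpace ℝ (Fin 4)) (c c' : Fin 3) :
    ContDiff ℝ ∞ fun x => A x v c c' := by
  have h1 : ContDiff ℝ ∞ fun x => A x v := hA.clm_apply contDiff_const
  exact (LinearMap.toContinuousLinearMap (Matrix.entryLinearMap ℝ ℂ c c')).contDiff.comp h1

/-- Partial derivatives of the components of a smooth spinor field are smooth. -/
theorem contDiff_fderiv_spinor_component {ψ : EuclideanSpace ℝ (Fin 4) → Fin 4 → Fin 3 → ℂ}
    (hψ : ContDiff ℝ ∞ ψ) (s : Fin 4) (c : Fin 3) (v : EuclideanSpace ℝ (Fin 4)) :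
    ContDiff ℝ ∞ fun x => fderiv ℝ (fun y => ψ y s c) x v :=
  ((contDiff_spinor_component hψ s c).fderiv_right (m := ∞) (by norm_cast)).clm_apply contDiff_const

/-- The covariant-derivative components `(∇_μψ)_{sc}(x) = ∂_μψ_{sc}(x) + Σ_{c'} (A x e_μ)_{cc'} ψ_{sc'}(x)`
of a smooth spinor field along a smooth connection are smooth. -/
theorem contDiff_covDeriv_component {A : Connection (EuclideanSpace ℝ (Fin 4)) (Matrix (Fin 3) (Fin 3) ℂ)}
    (hA : IsSmoothConnection A) {ψ : EuclideanSpace ℝ (Fin 4) → Fin 4 → Fin 3 → ℂ} (hψ : ContDiff ℝ ∞ ψ)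
    (μ : Fin 4) (s : Fin 4) (c : Fin 3) :
    ContDiff ℝ ∞ fun x => fderiv ℝ (fun y => ψ y s c) x (EuclideanSpace.single μ (1 : ℝ)) +
      ∑ c' : Fin 3, A x (EuclideanSpace.single μ (1 : ℝ)) c c' * ψ x s c' :=
  (contDiff_fderiv_spinor_component hψ s c _).add
    (ContDiff.sum fun c' _ => (contDiff_connection_entry hA _ c c').mul (contDiff_spinor_component hψ s c'))

/-- The real pairing `Re⟨ψ(x), ∇_μψ(x)⟩` is smooth. -/
theorem contDiff_re_inner_covDeriv {A : Connection (EuclideanSpace ℝ (Fin 4)) (Matrix (Fin 3) (Fin 3) ℂ)}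
    (hA : IsSmoothConnection A) {ψ : EuclideanSpace ℝ (Fin 4) → Fin 4 → Fin 3 → ℂ} (hψ : ContDiff ℝ ∞ ψ)
    (μ : Fin 4) :
    ContDiff ℝ ∞ fun y => (∑ s, ∑ c, starRingEnd ℂ (ψ y s c) *
      (fderiv ℝ (fun z => ψ z s c) y (EuclideanSpace.single μ (1 : ℝ)) +
        ∑ c' : Fin 3, A y (EuclideanSpace.single μ (1 : ℝ)) c c' * ψ y s c')).re := by
  have h : ContDiff ℝ ∞ fun y => ∑ s, ∑ c, starRingEnd ℂ (ψ y s c) *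
      (fderiv ℝ (fun z => ψ z s c) y (EuclideanSpace.single μ (1 : ℝ)) +
        ∑ c' : Fin 3, A y (EuclideanSpace.single μ (1 : ℝ)) c c' * ψ y s c') :=
    ContDiff.sum fun s _ => ContDiff.sum fun c _ =>
      (Complex.conjCLE.contDiff.comp (contDiff_spinor_component hψ s c)).mul
        (contDiff_covDeriv_component hA hψ μ s c)
  exact Complex.reCLM.contDiff.comp h

/-- The curvature of a smooth connection is continuous in the base point. -/
theorem continuous_curvature {A : Connection (EuclideanSpace ℝ (Fin 4)) (Matrix (Fin 3) (Fin 3) ℂ)}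
    (hA : IsSmoothConnection A) (u v : EuclideanSpace ℝ (Fin 4)) :
    Continuous fun x => curvature A x u v := by
  unfold curvature
  have h1 : ∀ w w' : EuclideanSpace ℝ (Fin 4), Continuous fun x => fderiv ℝ (fun y => A y w) x w' := by
    intro w w'
    have hs : ContDiff ℝ ∞ fun y => A y w := hA.clm_apply contDiff_const
    exact (hs.continuous_fderiv (by simp)).clm_apply continuous_const
  have h2 : ∀ w : EuclideanSpace ℝ (Fin 4), Continuous fun x => A x w := fun w =>
    (hA.continuous).clm_apply continuous_const
  simp only [Ring.lie_def]
  exact ((h1 v u).sub (h1 u v)).add (((h2 u).mul (h2 v)).sub ((h2 v).mul (h2 u)))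

/-- Entries of the derivative of a smooth connection: `(∂_u A_v)(x)_{cc'} = ∂_u (A_v)_{cc'} (x)`. -/
theorem fderiv_connection_apply_entry {A : Connection (EuclideanSpace ℝ (Fin 4)) (Matrix (Fin 3) (Fin 3) ℂ)}
    (hA : IsSmoothConnection A) (x u v : EuclideanSpace ℝ (Fin 4)) (c c' : Fin 3) :
    fderiv ℝ (fun y => A y v) x u c c' = fderiv ℝ (fun y => A y v c c') x u := by
  have hd : DifferentiableAt ℝ (fun y => A y v) x :=
    ((hA.clm_apply contDiff_const).differentiable (by simp)) x
  set T := LinearMap.toContinuousLinearMap (Matrix.entryLinearMap ℝ ℂ c c') with hT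
  have hcomp : (fun y => A y v c c') = T ∘ fun y => A y v := rfl
  have key : fderiv ℝ (fun y => A y v c c') x = T.comp (fderiv ℝ (fun y => A y v) x) := by
    rw [hcomp]
    exact (T.hasFDerivAt.comp x hd.hasFDerivAt).fderiv
  rw [key]
  rfl

/-- The derivative of an anti-Hermitian-valued smooth connection is anti-Hermitian:
`(∂_u A_v)ᴴ = −∂_u A_v`. -/
theorem fderiv_connection_conjTranspose {A : Connection (EuclideanSpace ℝ (Fin 4)) (Matrix (Fin 3) (Fin 3) ℂ)}
    (hA : IsSmoothConnection A) (hAH : ∀ x v, (A x v)ᴴ = -(A x v)) (x u v : EuclideanSpace ℝ (Fin 4)) :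
    (fderiv ℝ (fun y => A y v) x u)ᴴ = -(fderiv ℝ (fun y => A y v) x u) := by
  ext c c'
  rw [Matrix.conjTranspose_apply, Matrix.neg_apply, fderiv_connection_apply_entry hA,
    fderiv_connection_apply_entry hA]
  -- entry relation `A y v c' c = -conj (A y v c c')`
  have hrel : (fun y => A y v c' c) = fun y => -star (A y v c c') := by
    funext y
    have h := congrFun (congrFun (hAH y v) c') c
    rw [Matrix.conjTranspose_apply, Matrix.neg_apply] at h
    -- h : star (A y v c c') = -(A y v c' c)
    rw [h, neg_neg]
  have hd : DifferentiableAt ℝ (fun y => A y v c c') x :=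
    ((contDiff_connection_entry hA v c c').differentiable (by simp)) x
  have hstar : fderiv ℝ (fun y => -star (A y v c c')) x u = -star (fderiv ℝ (fun y => A y v c c') x u) := by
    rw [fderiv_fun_neg, (hd.hasFDerivAt.star).fderiv]
    rfl
  rw [hrel, hstar, star_neg, star_star]

/-- **The curvature of a smooth anti-Hermitian connection is anti-Hermitian.** -/
theorem curvature_conjTranspose {A : Connection (EuclideanSpace ℝ (Fin 4)) (Matrix (Fin 3) (Fin 3) ℂ)}
    (hA : IsSmoothConnection A) (hAH : ∀ x v, (A x v)ᴴ = -(A x v)) (x u v : EuclideanSpace ℝ (Fin 4)) :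
    (curvature A x u v)ᴴ = -(curvature A x u v) := by
  show (fderiv ℝ (fun y => A y v) x u - fderiv ℝ (fun y => A y u) x v + ⁅A x u, A x v⁆)ᴴ =
    -(fderiv ℝ (fun y => A y v) x u - fderiv ℝ (fun y => A y u) x v + ⁅A x u, A x v⁆)
  have h1 := fderiv_connection_conjTranspose hA hAH x u v
  have h2 := fderiv_connection_conjTranspose hA hAH x v u
  rw [Ring.lie_def, Matrix.conjTranspose_add, Matrix.conjTranspose_sub, Matrix.conjTranspose_sub,
    Matrix.conjTranspose_mul, Matrix.conjTranspose_mul, hAH x u, hAH x v, h1, h2]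
  simp only [neg_mul, mul_neg, neg_neg]
  abel

end Summit.QuantumFields.QCD.Cruxes.EarlyCrosserLaw.ZeroModeFloorDiluteGas

end
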